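import Summits.ResolutionOfSingularities.ResolutionOfSingularities.Theorems.PurelyInseparableDim4MilnorFinite
import Summits.ResolutionOfSingularities.ResolutionOfSingularities.Theorems.PurelyInseparableDim4ChartDictionary
import Summits.ResolutionOfSingularities.ResolutionOfSingularities.Theorems.PurelyInseparableDim4Directrix
import Summits.ResolutionOfSingularities.ResolutionOfSingularities.Theorems.WildConesClassicalRegimesStubMuDropCharTwoOrdPInduction
import Summits.ResolutionOfSingularities.ResolutionOfSingularities.Theorems.WildConesClassicalRegimes
import Literature.AlgebraicGeometry.Resolution.CentreBlowupMohStability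
import Mathlib.RingTheory.MvPowerSeries.Substitution
import HarnessLib
import HarnessLib.Audit.Tags

/-!
# F4-I at `(p, q) = (2, 2)` IS A TREE THEOREM: `NoIsolatedTrap 2 2`
# (bridge WildCones ↔ `PIDim4`, part 2; cell `res-dim4-pi`, p-12 bridge lead, desk WORD #30 (b))

[OURS · counted 0 · an assembly of theorems of this tree; nothing here is a statement of any
manuscript, and nothing here proves resolution of singularities in dimension ≥ 4 / characteristic `p`.]

**Theorem (`noIsolatedTrap_two_two`).** Over every field of characteristic `2` there is no infinite
sequence of point blow-ups of `z² + F(x₁, …, x₄)` (MODE-0 edges `PIDim4.Step0 2` of the cell's frame: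
chart, translation to a `2`-fold point of the exceptional divisor, cleaning) ALL of whose states are
ISOLATED `2`-fold points (`PIDim4.IsIsolated 2`: the `2`-fold locus `V(∂₁F, …, ∂₄F)` has the origin
as a component) — the frame statement F4-I `PIDim4.NoIsolatedTrap 2 2` of `PurelyInseparableDim4Scope`.

**Proof = bridge to the in-house route `WildCones`** (res-hironaka W4.1, landed 2026-08-17): its
`MuDropCharTwoOrdP.series_drop` says that for a FORMAL PAIR `(a, G)` over a field of characteristic `2`
— `2 ≤ ord a`, `G` without linear terms, `X_j² · G = a ∘ Φ_{j,b}` with `Φ_{j,b}(X_j) = X_j`,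
`Φ_{j,b}(X_t) = X_j (X_t + b_t)` — with both formal Milnor algebras `K⟦x⟧ ⧸ ⟨∂ᵢ·⟩` finite, the
Milnor number DROPS: `μ(G) < μ(a)` (hyperbolic-pair descent, Greuel–Pfister splitting, Max Noether).
For a frame edge `s → CentreBlowup.step 2 univ j b s` the pair `(↑s.F, ↑pointTransform)` is such a
pair:

* §1 `X_sq_mul_pointTransform_eq_aeval` / `X_sq_mul_coe_pointTransform_eq_subst` — the CHART
  IDENTITY `X_j² · (translated chart transform) = F ∘ Φ_{j,b}` (typ-2's
  `ChartDictionary.coordBlowupSubst_eq_X_pow_mul_chartTransform` followed by the translation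
  `x ↦ x + b`, `b_j = 0`, then coerced to `K⟦x⟧` by `MvPowerSeries.subst_coe`);
* §2 `two_le_order_coe` (Step0's `2 ≤ ord₀ F` IS `2 ≤ ord ↑F`), `coeff_single_coe_pointTransform`
  (equimultiple ⇒ no linear terms), `span_pderiv_coe_step` (cleaning deletes squares, whose
  derivatives vanish: the Milnor ideal of the cleaned successor is that of the point transform —
  p-12's `Directrix.pderiv_deletePthPowers`);
* §3 `milnor_lt_of_edge` — one `Step0` edge between Milnor-finite states drops
  `μ(s) := dim_K K⟦x⟧ ⧸ ⟨∂ᵢ ↑s.F⟩`; with part 1 (`milnorFinite_of_isIsolated_two`: isolated ⇒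
  Milnor-finite) every isolated `Step0` chain has strictly decreasing `μ`, which is absurd
  (`WildCones.no_strictAnti_nat`, the route's own closing step):
  **`noIsolatedTrap_two_two : NoIsolatedTrap 2 2`**, and by `IsolatedScope` the same for MODE 1h /
  every permissible rule (`no_isolated_step1h_chain_two`, `no_isolated_rule_chain_two`).

No perfect-field hypothesis, no base change and no coefficient-function calculus are needed on this
route (the formal-pair theorem is stated for every field of characteristic `2`).  For `p ≥ 3` the
analogous bridge would give only the MILNOR-FINITE sub-regime of F4-I(p,p) (the route's `Isol` uses
first derivatives, the frame's `J_p⁺` all Hasse derivatives of order `< p`).  Credit: the drop is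
`WildCones.MuDropCharTwoOrdP.series_drop` (res-hironaka W4.1 seats); the isolation certificate is
p-3's / p-14's (`IsolationCert`, `IsolationConverse`); the chart identity is typ-2's.
bears_on: LADDER-RESOLUTION:D157-DOOR2 (res-dim4-pi · F4-I(2,2)).
Supports stmt-ResolutionOfSingularities-16155 (helper).
-/

set_option linter.dupNamespace false

noncomputable section

namespace Summit.ResolutionOfSingularities.ResolutionOfSingularities.Theorems.PIDim4

namespace WildConesBridge

open MvPolynomial Finset
open Literature.AlgebraicGeometry.Resolution
open Literature.AlgebraicGeometry.Resolution.Hauser2010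

variable {K : Type} [Field K]

/-! ## 1. The chart identity `X_j² · pointTransform = F ∘ Φ_{j,b}` -/

/-- **Chart identity, polynomial level.** For a `2`-fold origin (`2 ≤ ord₀ F`) and a point `b` of the
exceptional divisor of the chart `x_j` (`b_j = 0`):
`x_j² · F'(x + b) = F(x_j, x_j (x_t + b_t))`, `F'` the chart transform.
[cite: Hauser2010, §F (chart expressions of a point blowup)] -/
theorem X_sq_mul_pointTransform_eq_aeval {s : State K} {j : Fin 4} {b : Fin 4 → K} (hb : b j = 0)
    (h2 : (2 : ℕ∞) ≤ CentreBlowup.ordAlong Finset.univ s.F) :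
    X j ^ 2 * CentreBlowup.pointTransform 2 Finset.univ j b s =
      MvPolynomial.aeval (fun t : Fin 4 => if t = j then (X j : MvPolynomial (Fin 4) K)
        else X j * (X t + C (b t))) s.F := by
  have h1 := ChartDictionary.coordBlowupSubst_eq_X_pow_mul_chartTransform
    (K := K) (Finset.mem_univ j) 2 s.F h2
  have h3 := congrArg (PointBlowup.translate b) h1
  unfold PointBlowup.translate at h3
  rw [map_mul, map_pow, MvPolynomial.aeval_X, hb, map_zero, add_zero] at h3
  rw [show CentreBlowup.pointTransform 2 Finset.univ j b s =
      PointBlowup.translate b (CentreBlowup.chartTransform 2 Finset.univ j s.F) from rfl]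
  unfold PointBlowup.translate
  rw [← h3]
  unfold coordBlowupSubst
  rw [← AlgHom.comp_apply, MvPolynomial.comp_aeval]
  refine congrArg (fun f : Fin 4 → MvPolynomial (Fin 4) K => MvPolynomial.aeval f s.F) ?_
  funext t
  by_cases ht : t = j
  · subst ht
    simp [hb]
  · simp [ht, hb]

/-- **Chart identity, formal level**: `X_j² · ↑(pointTransform) = subst Φ_{j,b} ↑F` in `K⟦x⟧`, with
`Φ_{j,b}` EXACTLY the substitution of `WildCones.MuDropCharTwoOrdP.series_drop`.
[cite: Hauser2010, §F (chart expressions of a point blowup)] -/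
theorem X_sq_mul_coe_pointTransform_eq_subst {s : State K} {j : Fin 4} {b : Fin 4 → K}
    (hb : b j = 0) (h2 : (2 : ℕ∞) ≤ CentreBlowup.ordAlong Finset.univ s.F) :
    (MvPowerSeries.X j : MvPowerSeries (Fin 4) K) ^ 2 *
        ((CentreBlowup.pointTransform 2 Finset.univ j b s : MvPolynomial (Fin 4) K) :
          MvPowerSeries (Fin 4) K) =
      MvPowerSeries.subst (fun t : Fin 4 => if t = j then (MvPowerSeries.X j : MvPowerSeries (Fin 4) K)
        else MvPowerSeries.X j * (MvPowerSeries.X t + MvPowerSeries.C (b t)))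
        (s.F : MvPowerSeries (Fin 4) K) := by
  rw [MvPowerSeries.subst_coe]
  have hcoe := congrArg (fun P : MvPolynomial (Fin 4) K => (P : MvPowerSeries (Fin 4) K))
    (X_sq_mul_pointTransform_eq_aeval hb h2)
  simp only [MvPolynomial.coe_mul, MvPolynomial.coe_pow, MvPolynomial.coe_X] at hcoe
  rw [hcoe]
  -- `↑(aeval φ F) = aeval (↑ ∘ φ) F`: two ring maps agreeing on constants and variables
  set φ : Fin 4 → MvPolynomial (Fin 4) K := fun t => if t = j then (X j : MvPolynomial (Fin 4) K)
    else X j * (X t + C (b t)) with hφ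
  set Φ : Fin 4 → MvPowerSeries (Fin 4) K := fun t =>
    if t = j then (MvPowerSeries.X j : MvPowerSeries (Fin 4) K)
    else MvPowerSeries.X j * (MvPowerSeries.X t + MvPowerSeries.C (b t)) with hΦ
  have hφΦ : ∀ t, ((φ t : MvPolynomial (Fin 4) K) : MvPowerSeries (Fin 4) K) = Φ t := by
    intro t
    by_cases ht : t = j
    · simp only [hφ, hΦ, ht, if_true, MvPolynomial.coe_X]
    · simp only [hφ, hΦ, ht, if_false, MvPolynomial.coe_mul, MvPolynomial.coe_add,
        MvPolynomial.coe_X, MvPolynomial.coe_C]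
  have key : (MvPolynomial.coeToMvPowerSeries.ringHom : MvPolynomial (Fin 4) K →+* _).comp
      (MvPolynomial.aeval (R := K) φ).toRingHom = (MvPolynomial.aeval (R := K) Φ).toRingHom := by
    refine MvPolynomial.ringHom_ext (fun r => ?_) (fun t => ?_)
    · simp only [RingHom.comp_apply, AlgHom.toRingHom_eq_coe, RingHom.coe_coe, MvPolynomial.algHom_C,
        MvPolynomial.algebraMap_eq, MvPowerSeries.algebraMap_apply, Algebra.algebraMap_self,
        RingHom.id_apply]
      exact MvPolynomial.coe_C r
    · simp only [RingHom.comp_apply, AlgHom.toRingHom_eq_coe, RingHom.coe_coe, MvPolynomial.aeval_X]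
      exact hφΦ t
  exact RingHom.congr_fun key s.F

/-! ## 2. The other hypotheses of the formal-pair theorem, read on frame states -/

/-- `2 ≤ ord_{C_univ} F` is `2 ≤ ord ↑F` (the tree's `ordZero` IS the power-series order). [folklore] -/
theorem two_le_order_coe {F : MvPolynomial (Fin 4) K}
    (h2 : (2 : ℕ∞) ≤ CentreBlowup.ordAlong Finset.univ F) :
    (2 : ℕ∞) ≤ (F : MvPowerSeries (Fin 4) K).order := by
  rw [CentreBlowup.ordAlong_univ] at h2
  exact h2

/-- An equimultiple point gives a point transform WITHOUT LINEAR TERMS. [cite: Hauser2010, §F (equiconstant points)] -/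
theorem coeff_single_coe_pointTransform [DecidableEq K] {s : State K} {j : Fin 4} {b : Fin 4 → K}
    (heq : CentreBlowup.IsEquimultiplePoint 2 Finset.univ j b s) (t : Fin 4) :
    MvPowerSeries.coeff (Finsupp.single t 1)
      ((CentreBlowup.pointTransform 2 Finset.univ j b s : MvPolynomial (Fin 4) K) :
        MvPowerSeries (Fin 4) K) = 0 := by
  rw [MvPolynomial.coeff_coe]
  exact heq _ (Finsupp.single_ne_zero.mpr one_ne_zero) (by rw [Finsupp.degree_single]; norm_num)

/-- **Cleaning does not change the formal Milnor ideal** (characteristic `2`: the deleted monomials are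
squares): the Milnor ideal of the cleaned successor `(step 2 univ j b s).F` is that of the point
transform. [cite: Hauser2010, §F (cleaning)] [folklore] -/
theorem span_pderiv_coe_step [CharP K 2] [DecidableEq K] (s : State K) (j : Fin 4) (b : Fin 4 → K) :
    Ideal.span (Set.range fun t : Fin 4 => MvPowerSeries.pderiv t
        (((CentreBlowup.step 2 Finset.univ j b s).F : MvPolynomial (Fin 4) K) : MvPowerSeries (Fin 4) K)) =
      Ideal.span (Set.range fun t : Fin 4 => MvPowerSeries.pderiv t
        ((CentreBlowup.pointTransform 2 Finset.univ j b s : MvPolynomial (Fin 4) K) :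
          MvPowerSeries (Fin 4) K)) := by
  have hfun : (fun t : Fin 4 => MvPowerSeries.pderiv t
        (((CentreBlowup.step 2 Finset.univ j b s).F : MvPolynomial (Fin 4) K) : MvPowerSeries (Fin 4) K)) =
      fun t : Fin 4 => MvPowerSeries.pderiv t
        ((CentreBlowup.pointTransform 2 Finset.univ j b s : MvPolynomial (Fin 4) K) :
          MvPowerSeries (Fin 4) K) := by
    funext t
    show MvPowerSeries.pderiv t ((deletePthPowers 2 (CentreBlowup.pointTransform 2 Finset.univ j b s) :
      MvPolynomial (Fin 4) K) : MvPowerSeries (Fin 4) K) = _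
    rw [MvPowerSeries.pderiv_coe, MvPowerSeries.pderiv_coe, Directrix.pderiv_deletePthPowers]
  rw [hfun]

/-! ## 3. One edge drops `μ`; F4-I(2,2) -/

/-- **One MODE-0 edge drops the formal Milnor number** (characteristic `2`): at an equimultiple point
`b` (`b_j = 0`) of the point blow-up of a `2`-fold state, if the formal Milnor algebras of the state and
of its cleaned successor are finite, then `μ(successor) < μ(state)`.  This is
`WildCones.MuDropCharTwoOrdP.series_drop` (res-hironaka W4.1) applied to the pair
`(↑s.F, ↑pointTransform)`. [cite: GreuelPfister2026, Thm 3.5 and Cor 3.7] -/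
theorem milnor_lt_of_edge [CharP K 2] [DecidableEq K] {s : State K} {j : Fin 4} {b : Fin 4 → K}
    (hb : b j = 0) (h2 : (2 : ℕ∞) ≤ CentreBlowup.ordAlong Finset.univ s.F)
    (heq : CentreBlowup.IsEquimultiplePoint 2 Finset.univ j b s)
    (hfin : Module.Finite K (MvPowerSeries (Fin 4) K ⧸ Ideal.span (Set.range fun t : Fin 4 =>
      MvPowerSeries.pderiv t ((s.F : MvPolynomial (Fin 4) K) : MvPowerSeries (Fin 4) K))))
    (hfin' : Module.Finite K (MvPowerSeries (Fin 4) K ⧸ Ideal.span (Set.range fun t : Fin 4 =>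
      MvPowerSeries.pderiv t (((CentreBlowup.step 2 Finset.univ j b s).F : MvPolynomial (Fin 4) K) :
        MvPowerSeries (Fin 4) K)))) :
    Module.finrank K (MvPowerSeries (Fin 4) K ⧸ Ideal.span (Set.range fun t : Fin 4 =>
        MvPowerSeries.pderiv t (((CentreBlowup.step 2 Finset.univ j b s).F : MvPolynomial (Fin 4) K) :
          MvPowerSeries (Fin 4) K))) <
      Module.finrank K (MvPowerSeries (Fin 4) K ⧸ Ideal.span (Set.range fun t : Fin 4 =>
        MvPowerSeries.pderiv t ((s.F : MvPolynomial (Fin 4) K) : MvPowerSeries (Fin 4) K))) := by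
  rw [span_pderiv_coe_step] at hfin' ⊢
  exact WildCones.MuDropCharTwoOrdP.series_drop 4 j b _ _ (two_le_order_coe h2)
    (coeff_single_coe_pointTransform heq) (X_sq_mul_coe_pointTransform_eq_subst hb h2) hfin hfin'

/-- **F4-I AT `(p, q) = (2, 2)` — `NoIsolatedTrap 2 2` IS A THEOREM OF THE TREE.**  Over every field of
characteristic `2` there is no infinite `Step0` chain of ISOLATED `2`-fold states of `z² + F(x₁..x₄)`:
the formal Milnor number `μ(s) = dim_K K⟦x⟧ ⧸ ⟨∂ᵢ ↑s.F⟩` is finite at isolated states (part 1) and drops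
on every edge (§3).  OURS: an assembly of the in-house route `WildCones` (res-hironaka W4.1:
`MuDropCharTwoOrdP.series_drop`), p-3's / p-14's isolation certificate and typ-2's chart dictionary;
counted 0; a statement about OUR frame at `(n, e, p) = (4, 1, 2)`, NOT a resolution theorem.
[cite: GreuelPfister2026, Thm 3.5 and Cor 3.7] -/
theorem noIsolatedTrap_two_two : NoIsolatedTrap 2 2 := by
  intro K _ _ _
  rintro ⟨c, hc⟩
  have hfin : ∀ k, Module.Finite K (MvPowerSeries (Fin 4) K ⧸ Ideal.span (Set.range fun t : Fin 4 =>
      MvPowerSeries.pderiv t (((c k).F : MvPolynomial (Fin 4) K) : MvPowerSeries (Fin 4) K))) :=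
    fun k => milnorFinite_of_isIsolated_two (hc k).1
  refine WildCones.no_strictAnti_nat (fun k => Module.finrank K (MvPowerSeries (Fin 4) K ⧸
    Ideal.span (Set.range fun t : Fin 4 =>
      MvPowerSeries.pderiv t (((c k).F : MvPolynomial (Fin 4) K) : MvPowerSeries (Fin 4) K)))) fun k => ?_
  obtain ⟨h2, j, b, -, hb, heq, -, hck⟩ := (hc k).2
  have hfin' := hfin (k + 1)
  show Module.finrank K (MvPowerSeries (Fin 4) K ⧸ Ideal.span (Set.range fun t : Fin 4 =>
      MvPowerSeries.pderiv t (((c (k + 1)).F : MvPolynomial (Fin 4) K) : MvPowerSeries (Fin 4) K))) < _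
  rw [hck] at hfin' ⊢
  exact milnor_lt_of_edge hb h2 heq (hfin k) hfin'

/-- The cell's QUESTION F4-I (`NoIsolatedTrapQuestion : ∀ p prime, NoIsolatedTrap p p`) holds at
`p = 2`. [OURS · counted 0] [folklore] -/
theorem noIsolatedTrapQuestion_two : NoIsolatedTrap 2 2 := noIsolatedTrap_two_two

/-- **No infinite isolated MODE-1h chain at `(2, 2)`** (at isolated states MODE 1h = MODE 0,
p-12's `IsolatedScope.step1h_iff_step0_of_isIsolated`). [OURS · counted 0] [folklore] -/
theorem no_isolated_step1h_chain_two (K : Type) [Field K] [CharP K 2] [DecidableEq K] :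
    ¬ ∃ c : ℕ → State K, ∀ k, IsIsolated 2 (c k).F ∧ Step1h 2 (c k) (c (k + 1)) := by
  rintro ⟨c, hc⟩
  exact noIsolatedTrap_two_two K ⟨c, fun k =>
    ⟨(hc k).1, (IsolatedScope.step1h_iff_step0_of_isIsolated (hc k).1).mp (hc k).2⟩⟩

/-- **No infinite isolated chain under ANY permissible coordinate rule at `(2, 2)`**
(`IsolatedScope.noIsolatedTrap_iff_forall_rule`). [OURS · counted 0] [folklore] -/
theorem no_isolated_rule_chain_two (K : Type) [Field K] [CharP K 2] [DecidableEq K]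
    (R : CentreRule K) (hR : IsPermissibleRule 2 R) :
    ¬ ∃ c : ℕ → State K, ∀ k, IsIsolated 2 (c k).F ∧ StepRule 2 R (c k) (c (k + 1)) :=
  (IsolatedScope.noIsolatedTrap_iff_forall_rule 2 2).mp noIsolatedTrap_two_two K R hR

end WildConesBridge

end Summit.ResolutionOfSingularities.ResolutionOfSingularities.Theorems.PIDim4

end
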